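import Summits.CriticalPhenomena.PercolationContinuityZ3.Theorems.PercNearOneGluingNoHeavyLowerTailCertGeneral
import Summits.CriticalPhenomena.PercolationContinuityZ3.Theorems.PercNearOneGluingNoHeavyLowerTailCertFast
import HarnessLib

/-!
# `NoHeavyLowerTail` (stmt-CriticalPhenomena-4575) — `COND₃`/`KN13` certificate wrapper, part 1b: the bucketed, merge-accumulating coefficient check

Support file (prover prim-ineq-prove-1; `--supports stmt-CriticalPhenomena-4575`).  Bookkeeping definitions + soundness; no sorries.  Independent of the
certificate structure: `plusTermsGB`/`minusTermsGB` (bucket-`b` sides of `CertGeneral.checkQB`, filtered row by row), `mergeAdd`, `mergePairs`, `accTreeF`,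
`accTerms` (normalise every column, then merge all columns in a balanced tree — memory ∝ distinct monomials, no global sort), `plusColsB`/`minusColsB`,
`checkQBm` (THE check: coefficientwise domination of the accumulated sides) and its soundness `soundQ_of_merged` (valid rows in sum + valid hypothesis rows +
all buckets pass ⇒ `0 ≤ M₀(x)·ts(x)`), via `CertCheck.evalT_le_of_dominated`, `perm_mergeF`, `evalT_group`, `evalT_normalize`, `evalT_eq_sum_buckets`.
-/

noncomputable section

namespace Summit.CriticalPhenomena.PercolationContinuityZ3.Theorems

open CertCheck

namespace CondCert


/-! ## The bucketed, merge-accumulating coefficient check (independent of the certificate structure) -/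

/-- Bucket-`b` plus side, filtered row by row (same list as filtering `plusTermsG`, smaller peak memory). [folklore] -/
def plusTermsGB (nb b : ℕ) (plus : List Term) (rows : List Row) (lrows : List LinRow) : List Term :=
  (plus.filter fun t => bucket nb t == b) ++
    (rows.flatMap fun r => (pairTerms r.e3 r.e4 r.mult r.wt).filter fun t => bucket nb t == b) ++
      lrows.flatMap fun r => (linTerms r.eHi r.mult r.wt).filter fun t => bucket nb t == b

/-- Bucket-`b` minus side, filtered row by row. [folklore] -/
def minusTermsGB (nb b : ℕ) (minus : List Term) (rows : List Row) (lrows : List LinRow) : List Term :=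
  (minus.filter fun t => bucket nb t == b) ++
    (rows.flatMap fun r => (pairTerms r.e1 r.e2 r.mult r.wt).filter fun t => bucket nb t == b) ++
      lrows.flatMap fun r => (linTerms r.eLo r.mult r.wt).filter fun t => bucket nb t == b

/-- The row-by-row filtered plus side is the filtered plus side. [folklore] -/
theorem plusTermsGB_eq (nb b : ℕ) (plus : List Term) (rows : List Row) (lrows : List LinRow) :
    plusTermsGB nb b plus rows lrows = (plusTermsG plus rows lrows).filter fun t => bucket nb t == b := by
  simp only [plusTermsGB, plusTermsG, List.filter_append, CertCheck.filter_flatMap']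

/-- The row-by-row filtered minus side is the filtered minus side. [folklore] -/
theorem minusTermsGB_eq (nb b : ℕ) (minus : List Term) (rows : List Row) (lrows : List LinRow) :
    minusTermsGB nb b minus rows lrows = (minusTermsG minus rows lrows).filter fun t => bucket nb t == b := by
  simp only [minusTermsGB, minusTermsG, List.filter_append, CertCheck.filter_flatMap']

/-! ### Merge-accumulating check (normalise each column, then merge the columns pairwise in a balanced tree; memory ∝ distinct monomials) -/

/-- Merge two grouped sorted term lists into one (adding coefficients of equal monomials). [folklore] -/
def mergeAdd (a b : List Term) : List Term := group (mergeF (a.length + b.length + 1) a b)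

/-- The value of a merge is the sum of the values. [folklore] -/
theorem evalT_mergeAdd (x : ℕ → ℝ) (a b : List Term) : evalT x (mergeAdd a b) = evalT x a + evalT x b := by
  unfold mergeAdd
  rw [evalT_group, evalT_perm x (perm_mergeF _ _ _), evalT_append]

/-- Merge adjacent pairs of a list of term lists. [folklore] -/
def mergePairs : List (List Term) → List (List Term)
  | [] => []
  | [a] => [a]
  | a :: b :: rest => mergeAdd a b :: mergePairs rest

/-- `mergePairs` preserves the total value. [folklore] -/
theorem evalT_flatten_mergePairs (x : ℕ → ℝ) : ∀ cols : List (List Term),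
    evalT x (mergePairs cols).flatten = evalT x cols.flatten
  | [] => rfl
  | [a] => rfl
  | a :: b :: rest => by
    rw [mergePairs, List.flatten_cons, evalT_append, evalT_mergeAdd, evalT_flatten_mergePairs x rest, List.flatten_cons,
      List.flatten_cons, evalT_append, evalT_append]
    ring

/-- Balanced merging of all columns (structural in the fuel; with enough fuel a single grouped sorted list). [folklore] -/
def accTreeF : ℕ → List (List Term) → List Term
  | 0, cols => cols.flatten
  | _ + 1, [] => []
  | _ + 1, [a] => a
  | f + 1, a :: b :: rest => accTreeF f (mergePairs (a :: b :: rest))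

/-- The value of the balanced merge is the value of the concatenation. [folklore] -/
theorem evalT_accTreeF (x : ℕ → ℝ) : ∀ (f : ℕ) (cols : List (List Term)), evalT x (accTreeF f cols) = evalT x cols.flatten
  | 0, cols => rfl
  | _ + 1, [] => rfl
  | _ + 1, [a] => by simp [accTreeF]
  | f + 1, a :: b :: rest => by
    rw [accTreeF, evalT_accTreeF x f, evalT_flatten_mergePairs]

/-- Normalise every column, then merge them all. [folklore] -/
def accTerms (cols : List (List Term)) : List Term := accTreeF cols.length (cols.map normalize)

/-- The value of the accumulated list is the value of the concatenation. [folklore] -/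
theorem evalT_accTerms (x : ℕ → ℝ) (cols : List (List Term)) : evalT x (accTerms cols) = evalT x cols.flatten := by
  unfold accTerms
  rw [evalT_accTreeF]
  induction cols with
  | nil => rfl
  | cons c t ih => rw [List.map_cons, List.flatten_cons, List.flatten_cons, evalT_append, evalT_append, ih, evalT_normalize]

/-- Bucket-`b` plus-side columns (explicit terms, row large sides, hypothesis high sides). [folklore] -/
def plusColsB (nb b : ℕ) (plus : List Term) (rows : List Row) (lrows : List LinRow) : List (List Term) :=
  [plus.filter fun t => bucket nb t == b] ++
    (rows.map fun r => (pairTerms r.e3 r.e4 r.mult r.wt).filter fun t => bucket nb t == b) ++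
      lrows.map fun r => (linTerms r.eHi r.mult r.wt).filter fun t => bucket nb t == b

/-- Bucket-`b` minus-side columns. [folklore] -/
def minusColsB (nb b : ℕ) (minus : List Term) (rows : List Row) (lrows : List LinRow) : List (List Term) :=
  [minus.filter fun t => bucket nb t == b] ++
    (rows.map fun r => (pairTerms r.e1 r.e2 r.mult r.wt).filter fun t => bucket nb t == b) ++
      lrows.map fun r => (linTerms r.eLo r.mult r.wt).filter fun t => bucket nb t == b

/-- `flatMap` as `flatten ∘ map`. [folklore] -/
theorem flatten_map_eq_flatMap {α β : Type*} (l : List α) (f : α → List β) : (l.map f).flatten = l.flatMap f := by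
  induction l with
  | nil => rfl
  | cons a t ih => simp [List.flatMap_cons, ih]

/-- The plus columns concatenate to the bucket-`b` plus side. [folklore] -/
theorem flatten_plusColsB (nb b : ℕ) (plus : List Term) (rows : List Row) (lrows : List LinRow) :
    (plusColsB nb b plus rows lrows).flatten = plusTermsGB nb b plus rows lrows := by
  simp only [plusColsB, plusTermsGB, List.flatten_append, List.flatten_cons, List.flatten_nil, List.append_nil,
    flatten_map_eq_flatMap]

/-- The minus columns concatenate to the bucket-`b` minus side. [folklore] -/
theorem flatten_minusColsB (nb b : ℕ) (minus : List Term) (rows : List Row) (lrows : List LinRow) :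
    (minusColsB nb b minus rows lrows).flatten = minusTermsGB nb b minus rows lrows := by
  simp only [minusColsB, minusTermsGB, List.flatten_append, List.flatten_cons, List.flatten_nil, List.append_nil,
    flatten_map_eq_flatMap]

/-- THE MERGE-ACCUMULATING bucketed quadratic check (bucket `b` of `nb`; `nb = 1` = everything at once). [folklore] -/
def checkQBm (nb b : ℕ) (M0 : List (List ℕ × ℕ)) (ts : List QTerm) (rows : List Row) (lrows : List LinRow) : Bool :=
  dominated (accTerms (plusColsB nb b (qTerms M0 ts false) rows lrows)) (accTerms (minusColsB nb b (qTerms M0 ts true) rows lrows))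

/-- **Soundness of the merge-accumulating check**: valid rows (in sum), valid hypothesis rows, all buckets pass ⇒ `0 ≤ M₀(x)·ts(x)`.
[folklore] -/
theorem soundQ_of_merged (x : ℕ → ℝ) (hx : ∀ i, 0 ≤ x i) (M0 : List (List ℕ × ℕ)) (ts : List QTerm) (rows : List Row)
    (lrows : List LinRow) {nb : ℕ} (hnb : 0 < nb)
    (hrows : (rows.map fun r => (r.wt : ℝ) * evalM x r.mult * (linEval x r.e1 * linEval x r.e2)).sum ≤
      (rows.map fun r => (r.wt : ℝ) * evalM x r.mult * (linEval x r.e3 * linEval x r.e4)).sum)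
    (hlrows : ∀ r ∈ lrows, linEval x r.eLo ≤ linEval x r.eHi)
    (h : ∀ b < nb, checkQBm nb b M0 ts rows lrows = true) : 0 ≤ m0val x M0 * qval x ts := by
  have hdom : evalT x (plusTermsG (qTerms M0 ts false) rows lrows) ≤ evalT x (minusTermsG (qTerms M0 ts true) rows lrows) := by
    rw [evalT_eq_sum_buckets x hnb (plusTermsG _ rows lrows), evalT_eq_sum_buckets x hnb (minusTermsG _ rows lrows)]
    apply List.sum_le_sum
    intro b hb
    have hc := h b (List.mem_range.1 hb)
    have := evalT_le_of_dominated x hx _ _ hc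
    rwa [evalT_accTerms, evalT_accTerms, flatten_plusColsB, flatten_minusColsB, plusTermsGB_eq, minusTermsGB_eq] at this
  have key := le_of_evalT_G_le x hx _ _ rows lrows hrows hlrows hdom
  rw [evalT_qTerms, evalT_qTerms] at key
  rw [qval_eq, mul_sub]
  linarith

end CondCert

end Summit.CriticalPhenomena.PercolationContinuityZ3.Theorems

end
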